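import Mathlib
import Literature.MathematicalPhysics.QuantumFieldTheory.MirrorRPKernel

/-!
# Crux `HyperoctahedralRP.HRP2Rigidity` (stmt-CriticalPhenomena-1979) — negative-side support: `n ≠ 0` in S1

Line `xray-mellin-transfer`, stub `stub_halfPlaneContinuation` (S1, per-mirror half-plane continuation, stated
over an arbitrary real inner product space `E` and an arbitrary kernel `K`).  Refuter (drefute gen-2)
LOAD-BEARING LEMMA: the hypothesis `n ≠ 0` cannot be dropped from the registered statement.  At `n = 0` the unit
normal `‖n‖⁻¹ • n` is `0`, the open half-space is empty (reflection positivity and the slab bound are vacuous,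
`θ₀ = id`), and the conclusion degenerates to `|K y| ≤ K 0` for every `y`, which the step kernel
`K = 𝟙_{x ≠ 0}` on `E = ℝ` violates (`K 1 = 1 > 0 = K 0`).  Theorem-only file.
-/

noncomputable section

namespace Summit.CriticalPhenomena.Ising3DConformalLimit.Theorems.HRP2Rigidity.Negative

open Literature.MathematicalPhysics.QuantumFieldTheory

/-- `𝟙_{x ≠ 0}` (as `Set.indicator {0}ᶜ 1`) is continuous off `0` (it is `1` there). [folklore] -/
theorem indicator_compl_zero_continuousOn :
    ContinuousOn (({0}ᶜ : Set ℝ).indicator fun _ => (1 : ℝ)) {0}ᶜ :=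
  (continuousOn_const (c := (1 : ℝ))).congr fun _ hx => Set.indicator_of_mem hx _

/-- **`n ≠ 0` is load-bearing in S1 (`stub_halfPlaneContinuation`).** The registered statement with the
hypothesis `n ≠ 0` removed (everything else verbatim) is false: `E = ℝ`, `n = 0`, `K = 𝟙_{x ≠ 0}`, `y = 1`
(`K 1 = 1` would have to be bounded by `K 0 = 0`). [folklore] -/
theorem halfPlaneContinuation_false_without_ne_zero :
    ¬ (∀ (E : Type) [NormedAddCommGroup E] [InnerProductSpace ℝ E] (K : E → ℝ) (n : E),
      ContinuousOn K {0}ᶜ → (∀ x, K (-x) = K x) →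
      (∀ t₀ : ℝ, 0 < t₀ → ∃ M : ℝ, ∀ x : E, t₀ ≤ inner ℝ x (‖n‖⁻¹ • n) → |K x| ≤ M) →
      (∀ x, K (((ℝ ∙ n)ᗮ).reflection x) = K x) → IsMirrorRPKernel n K →
      ∀ y : E, inner ℝ y n = 0 →
        ∃ F : ℂ → ℂ, DifferentiableOn ℂ F {t : ℂ | 0 < t.re} ∧
          (∀ t : ℝ, 0 < t → F t = ((K (t • ‖n‖⁻¹ • n + y) : ℝ) : ℂ)) ∧
          (∀ t : ℂ, 0 < t.re → ‖F t‖ ≤ K (t.re • ‖n‖⁻¹ • n))) := by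
  intro h
  set K : ℝ → ℝ := ({0}ᶜ : Set ℝ).indicator fun _ => (1 : ℝ) with hK
  have hK0 : K 0 = 0 := Set.indicator_of_notMem (by simp) _
  have hK1 : K 1 = 1 := Set.indicator_of_mem (by simp) _
  have heven : ∀ x : ℝ, K (-x) = K x := fun x => by
    by_cases hx : x = 0
    · simp [hx]
    · rw [hK, Set.indicator_of_mem (by simpa using hx), Set.indicator_of_mem (by simpa using hx)]
  have hslab : ∀ t₀ : ℝ, 0 < t₀ → ∃ M : ℝ, ∀ x : ℝ,
      t₀ ≤ inner ℝ x (‖(0 : ℝ)‖⁻¹ • (0 : ℝ)) → |K x| ≤ M := fun t₀ _ => ⟨1, fun x _ => by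
    by_cases hx : x = 0
    · rw [hx, hK0]; simp
    · rw [hK, Set.indicator_of_mem (by simpa using hx)]; simp⟩
  have hinv : ∀ x : ℝ, K (((ℝ ∙ (0 : ℝ))ᗮ).reflection x) = K x := fun x => by
    rw [mirrorReflection_of_inner_eq_zero (inner_zero_right x)]
  obtain ⟨F, -, hF1, hF2⟩ := h ℝ K 0 indicator_compl_zero_continuousOn heven hslab hinv
    (IsMirrorRPKernel.of_normal_eq_zero K) 1 (inner_zero_right _)
  have h1 := hF1 1 one_pos
  have h2 := hF2 1 (by simp)
  simp only [smul_zero, zero_add, Complex.ofReal_one, Complex.one_re] at h1 h2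
  rw [h1, hK1, hK0] at h2
  norm_num at h2

end Summit.CriticalPhenomena.Ising3DConformalLimit.Theorems.HRP2Rigidity.Negative

end
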